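import Summits.SmoothPoincare4.SmoothPoincare4.Theorems.DottedCircleRasmussenDcrGapHelperHandlebodyChartModelHandlesPhaseAux
import Summits.SmoothPoincare4.SmoothPoincare4.Theorems.DottedCircleRasmussenDcrGapHelperHandlebodyChartModelHandlesPolar
import Summits.SmoothPoincare4.SmoothPoincare4.Theorems.DottedCircleRasmussenDcrGapHelperHandlebodyChartModelHandlesGeometry

/-!
# Helper `helper_handlebodyChart_modelHandles` (M3: handle structure of the model dotted handlebody `D_k`)
# of line `mk_friends` for crux `DcrGap` — handle charts, part 6: the holes seen from the base centre
(item stmt-SmoothPoincare4-16128, route route-SmoothPoincare4-DottedCircleRasmussen)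

Towards the registered stub `helper_handlebodyChart_modelHandles_data_part1`.  The base centre is
`z₀ = -20k i`, below the row of holes `c_j = 4(j + 1)`, so that the directions `v_j = c_j - z₀ = 4(j+1) + 20k i`
(`|v_j| ≥ 20`, `|v_j|² ≤ 416 k²`) are pairwise well separated: `Im(v_j \bar v_l) = 80k(l - j)`
(`ModelHandles.holeDir_props`, `ModelHandles.holePair_props`).  A point of handle tube `j` has
`z = z₀ + ρ v_j (1 + i m/|v_j|)` (`ρ = r'/σ ∈ (0, 11/10]`, `|m| ≤ 1.78`): `ModelHandles.tubePoint_eqs` (its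
coordinates relative to `c_j`), `ModelHandles.tubePoint_norm_le` (`|z| ≤ 20(k + 1)`),
`ModelHandles.tubePoint_otherHole` (for `l ≠ j`, `|z - c_l| ≥ 27/20` and `Im((z - c_l)\overline{(z₀ - c_l)}) ≠ 0`:
the ball branch about hole `l` is smooth along tube `j`), `ModelHandles.tubePoints_ne` (distinct tubes have
distinct `z`), `ModelHandles.mem_modelHandlebody_of_far` (`|z| ≤ 20(k+1)`, all holes at distance `≥ 27/20`,
`|w|² ≤ 1/20` ⟹ `(z, w) ∈ D_k ∩ {G_k < 1}`, by the zone estimates of `MMSWRasmussenGeneralPosition`),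
`ModelHandles.baseBall_subset` (`B̄((z₀, 0), 1/5) ⊆ D_k`), `ModelHandles.arg_end_value`
(`arg w + arg v = arg(-w) + arg(-v) + 2π [Im w > 0]`: the end values of the lift about the tube's own hole),
`ModelHandles.lift_props` (smoothness and exponential of a lift off its branch cut).

Registered summary `helper_handlebodyChart_modelHandles_holesFromCentre`.  No definitions, no named facts,
no `sorry`.  References: R. Kirby, *The Topology of 4-Manifolds*, LNM 1374 (1989), Ch. I §2 [Kirby1989].
-/

-- the prescribed namespace `Summit.<P>.<Sub>.…` duplicates `SmoothPoincare4` (P = Sub)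
set_option linter.dupNamespace false
set_option linter.style.longLine false
noncomputable section

open scoped Manifold ContDiff Topology ComplexConjugate
open Function Set Metric Filter
open Literature.Topology.FourManifolds Literature.Topology.FourManifolds.MMSW
open Literature.AlgebraicTopology.Homotopy.HopfFibration

namespace Summit.SmoothPoincare4.SmoothPoincare4.Theorems.DcrGap.MkFriends

namespace ModelHandles

/-! ## The directions of the holes -/

/-- **The direction `v_j = c_j - z₀ = 4(j+1) + 20k i` of hole `j` from the base centre `z₀ = -20k i`.**
[folklore] -/
theorem holeDir_props {k : ℕ} (j : Fin k) {v : ℂ} (hv : v = holeCentre k j - Complex.mk 0 (-(20 * (k : ℝ)))) :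
    v.re = 4 * ((j : ℕ) : ℝ) + 4 ∧ v.im = 20 * k ∧ 1 ≤ (k : ℝ) ∧ ((j : ℕ) : ℝ) + 1 ≤ k ∧
      ‖v‖ ^ 2 = v.re ^ 2 + v.im ^ 2 ∧ 20 ≤ ‖v‖ ∧ ‖v‖ ^ 2 ≤ 416 * (k : ℝ) ^ 2 ∧ v ≠ 0 ∧ 0 < ‖v‖ := by
  have hre : v.re = 4 * ((j : ℕ) : ℝ) + 4 := by rw [hv]; simp [holeCentre]; ring
  have him : v.im = 20 * k := by rw [hv]; simp [holeCentre]
  have hk : 1 ≤ (k : ℝ) := by exact_mod_cast Nat.succ_le_of_lt (Fin.pos j)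
  have hj : ((j : ℕ) : ℝ) + 1 ≤ k := by exact_mod_cast Nat.succ_le_of_lt j.2
  have hsq : ‖v‖ ^ 2 = v.re ^ 2 + v.im ^ 2 := by rw [← Complex.normSq_eq_norm_sq, Complex.normSq_apply]; ring
  have h400 : (400 : ℝ) ≤ ‖v‖ ^ 2 := by rw [hsq, hre, him]; nlinarith
  have h20 : 20 ≤ ‖v‖ := by nlinarith [norm_nonneg v]
  refine ⟨hre, him, hk, hj, hsq, h20, ?_, ?_, by linarith⟩
  · rw [hsq, hre, him]
    have hj0 : (0 : ℝ) ≤ (j : ℕ) := by positivity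
    nlinarith
  · intro h0; rw [h0, norm_zero] at h20; linarith

/-- **Two distinct holes seen from the base centre**: `v_j \bar v_l` has positive real part `≤ |v_j| |v_l|` and
imaginary part `80k(l - j)`, of size `≥ 80k`. [folklore] -/
theorem holePair_props {k : ℕ} {j l : Fin k} (hjl : j ≠ l) {v v' : ℂ}
    (hv : v = holeCentre k j - Complex.mk 0 (-(20 * (k : ℝ))))
    (hv' : v' = holeCentre k l - Complex.mk 0 (-(20 * (k : ℝ)))) :
    (v * conj v').re = v.re * v'.re + v.im * v'.im ∧ (v * conj v').im = 80 * k * (((l : ℕ) : ℝ) - ((j : ℕ) : ℝ)) ∧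
      80 * (k : ℝ) ≤ |(v * conj v').im| ∧ 0 < (v * conj v').re ∧ (v * conj v').re ≤ ‖v‖ * ‖v'‖ := by
  obtain ⟨hre, him, hk, -, -, -, -, -, -⟩ := holeDir_props j hv
  obtain ⟨hre', him', -, -, -, -, -, -, -⟩ := holeDir_props l hv'
  have h1 : (v * conj v').re = v.re * v'.re + v.im * v'.im := by simp [Complex.mul_re]
  have h2 : (v * conj v').im = 80 * k * (((l : ℕ) : ℝ) - ((j : ℕ) : ℝ)) := by
    simp only [Complex.mul_im, Complex.conj_re, Complex.conj_im, hre, him, hre', him']; ring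
  refine ⟨h1, h2, ?_, ?_, ?_⟩
  · rw [h2, abs_mul, abs_of_pos (by positivity : (0 : ℝ) < 80 * k)]
    have hne : ((j : ℕ) : ℝ) ≠ ((l : ℕ) : ℝ) := by
      intro h; apply hjl; exact Fin.ext (by exact_mod_cast h)
    have h1' : (1 : ℝ) ≤ |(((l : ℕ) : ℝ)) - ((j : ℕ) : ℝ)| := by
      rcases lt_or_gt_of_ne hne with h | h
      · have : (j : ℕ) < (l : ℕ) := by exact_mod_cast h
        have : ((j : ℕ) : ℝ) + 1 ≤ (l : ℕ) := by exact_mod_cast this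
        rw [abs_of_pos (by linarith)]; linarith
      · have : (l : ℕ) < (j : ℕ) := by exact_mod_cast h
        have : ((l : ℕ) : ℝ) + 1 ≤ (j : ℕ) := by exact_mod_cast this
        rw [abs_of_neg (by linarith)]; linarith
    nlinarith
  · rw [h1, hre, him, hre', him']; positivity
  · calc (v * conj v').re ≤ ‖v * conj v'‖ := Complex.re_le_norm _
      _ = ‖v‖ * ‖v'‖ := by rw [norm_mul, Complex.norm_conj]

/-! ## A point of a handle tube -/

/-- **Coordinates of a tube point relative to its own hole**: for `z = z₀ + r' (v/|v|) e(m)`,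
`e(m) = (|v| + i m)/σ`, `σ = √(|v|² + m²)`, and `c = z₀ + v`:
`z - c = v ((r'/σ - 1) + i r' m/(|v| σ))`, `|z - c|² = (r' |v|/σ - |v|)² + (r' m/σ)²`,
`Re((z - c)\bar v) = |v|² (r'/σ - 1)`, `Im((z - c)\bar v) = |v| r' m/σ`, and
`z = (1 - r'/σ) z₀ + (r'/σ) c + i (r' m/(|v| σ)) v`. [folklore] -/
theorem tubePoint_eqs {v z₀ z : ℂ} {m r' : ℝ} (hv0 : v ≠ 0)
    (hz : z = z₀ + ((r' : ℝ) : ℂ) * (v / ((‖v‖ : ℝ) : ℂ)) *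
      ((((‖v‖ : ℝ) : ℂ) + (m : ℂ) * Complex.I) * (((Real.sqrt (‖v‖ ^ 2 + m ^ 2))⁻¹ : ℝ) : ℂ))) :
    z - (z₀ + v) = v * (((r' / Real.sqrt (‖v‖ ^ 2 + m ^ 2) - 1 : ℝ) : ℂ) +
      ((r' * m / (‖v‖ * Real.sqrt (‖v‖ ^ 2 + m ^ 2)) : ℝ) : ℂ) * Complex.I) ∧
    ‖z - (z₀ + v)‖ ^ 2 = (r' * ‖v‖ / Real.sqrt (‖v‖ ^ 2 + m ^ 2) - ‖v‖) ^ 2 + (r' * m / Real.sqrt (‖v‖ ^ 2 + m ^ 2)) ^ 2 ∧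
    ((z - (z₀ + v)) * conj v).re = ‖v‖ ^ 2 * (r' / Real.sqrt (‖v‖ ^ 2 + m ^ 2) - 1) ∧
    ((z - (z₀ + v)) * conj v).im = ‖v‖ * (r' * m / Real.sqrt (‖v‖ ^ 2 + m ^ 2)) ∧
    z = ((1 - r' / Real.sqrt (‖v‖ ^ 2 + m ^ 2) : ℝ) : ℂ) * z₀ + ((r' / Real.sqrt (‖v‖ ^ 2 + m ^ 2) : ℝ) : ℂ) * (z₀ + v) +
      ((r' * m / (‖v‖ * Real.sqrt (‖v‖ ^ 2 + m ^ 2)) : ℝ) : ℂ) * v * Complex.I := by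
  set σ := Real.sqrt (‖v‖ ^ 2 + m ^ 2) with hσ
  have hV : 0 < ‖v‖ := norm_pos_iff.2 hv0
  have hVc : ((‖v‖ : ℝ) : ℂ) ≠ 0 := by exact_mod_cast hV.ne'
  have hσpos : 0 < σ := Real.sqrt_pos.2 (by positivity)
  have hσc : ((σ : ℝ) : ℂ) ≠ 0 := by exact_mod_cast hσpos.ne'
  have h1 : z - (z₀ + v) = v * (((r' / σ - 1 : ℝ) : ℂ) + ((r' * m / (‖v‖ * σ) : ℝ) : ℂ) * Complex.I) := by
    rw [hz]; push_cast; field_simp; ring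
  have hvv : v * conj v = ((‖v‖ ^ 2 : ℝ) : ℂ) := by rw [Complex.mul_conj, Complex.normSq_eq_norm_sq]
  refine ⟨h1, ?_, ?_, ?_, ?_⟩
  · rw [h1, norm_mul, mul_pow, Complex.norm_add_mul_I, Real.sq_sqrt (by positivity)]; field_simp
  · rw [h1, mul_comm v, mul_assoc, hvv]
    simp only [Complex.mul_re, Complex.add_re, Complex.add_im, Complex.ofReal_re, Complex.ofReal_im,
      Complex.mul_im, Complex.I_re, Complex.I_im]
    ring
  · rw [h1, mul_comm v, mul_assoc, hvv]
    simp only [Complex.mul_re, Complex.add_re, Complex.add_im, Complex.ofReal_re, Complex.ofReal_im,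
      Complex.mul_im, Complex.I_re, Complex.I_im]
    field_simp; ring
  · push_cast at h1 ⊢; linear_combination h1

/-- The norm of the base centre `z₀ = -20k i` is `20k`, and `|c_j| ≤ 4k`. [folklore] -/
theorem norm_centre_holeCentre (k : ℕ) :
    ‖(Complex.mk 0 (-(20 * (k : ℝ))) : ℂ)‖ = 20 * k ∧ ∀ j : Fin k, ‖holeCentre k j‖ ≤ 4 * k := by
  constructor
  · rw [Complex.norm_eq_sqrt_sq_add_sq]
    rw [show (Complex.mk 0 (-(20 * (k : ℝ)))).re ^ 2 + (Complex.mk 0 (-(20 * (k : ℝ)))).im ^ 2 = (20 * (k : ℝ)) ^ 2 by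
      simp]
    exact Real.sqrt_sq (by positivity)
  · intro j
    have hj : ((j : ℕ) : ℝ) + 1 ≤ k := by exact_mod_cast Nat.succ_le_of_lt j.2
    rw [show holeCentre k j = (((4 * (((j : ℕ) : ℝ) + 1)) : ℝ) : ℂ) from rfl, Complex.norm_real,
      Real.norm_eq_abs, abs_of_pos (by positivity)]
    linarith

/-- **A tube point is not too far out**: `|z| ≤ 20(k + 1)` for `z = (1 - ρ) z₀ + ρ c_j + i μ v` with
`0 < ρ ≤ 11/10`, `|μ| |v| ≤ 1.78 ρ` (`z₀ = -20k i`, `v = c_j - z₀`). [folklore] -/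
theorem tubePoint_norm_le {k : ℕ} (j : Fin k) {v : ℂ} (hv : v = holeCentre k j - Complex.mk 0 (-(20 * (k : ℝ))))
    {ρ μ : ℝ} (hρ0 : 0 < ρ) (hρ1 : ρ ≤ 11 / 10) (hμ : |μ| * ‖v‖ ≤ ρ * (178 / 100)) (z : ℂ)
    (hz : z = ((1 - ρ : ℝ) : ℂ) * Complex.mk 0 (-(20 * (k : ℝ))) + (ρ : ℂ) * (Complex.mk 0 (-(20 * (k : ℝ))) + v) +
      (μ : ℂ) * v * Complex.I) :
    ‖z‖ ≤ 40 * ((k : ℝ) + 1) / 2 := by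
  obtain ⟨-, -, hk, -, -, h20, h416, -, hVpos⟩ := holeDir_props j hv
  obtain ⟨hz0, hcn'⟩ := norm_centre_holeCentre k
  have hcn := hcn' j
  have hc : Complex.mk 0 (-(20 * (k : ℝ))) + v = holeCentre k j := by rw [hv]; ring
  have hμv : ‖(μ : ℂ) * v * Complex.I‖ ≤ ρ * (178 / 100) := by
    rw [norm_mul, norm_mul, Complex.norm_I, mul_one, Complex.norm_real, Real.norm_eq_abs]; exact hμ
  rw [hz, hc]
  rcases le_or_gt ρ 1 with hρ | hρ
  · calc ‖((1 - ρ : ℝ) : ℂ) * Complex.mk 0 (-(20 * (k : ℝ))) + (ρ : ℂ) * holeCentre k j + (μ : ℂ) * v * Complex.I‖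
        ≤ ‖((1 - ρ : ℝ) : ℂ) * Complex.mk 0 (-(20 * (k : ℝ)))‖ + ‖(ρ : ℂ) * holeCentre k j‖ + ‖(μ : ℂ) * v * Complex.I‖ :=
          norm_add₃_le
      _ ≤ (1 - ρ) * (20 * k) + ρ * (4 * k) + ρ * (178 / 100) := by
          gcongr
          · rw [norm_mul, Complex.norm_real, Real.norm_eq_abs, abs_of_nonneg (by linarith), hz0]
          · rw [norm_mul, Complex.norm_real, Real.norm_eq_abs, abs_of_pos hρ0]; gcongr
      _ ≤ 40 * ((k : ℝ) + 1) / 2 := by nlinarith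
  · have e : ((1 - ρ : ℝ) : ℂ) * Complex.mk 0 (-(20 * (k : ℝ))) + (ρ : ℂ) * holeCentre k j + (μ : ℂ) * v * Complex.I =
        holeCentre k j + ((ρ - 1 : ℝ) : ℂ) * v + (μ : ℂ) * v * Complex.I := by
      rw [← hc]; push_cast; ring
    rw [e]
    have hV : ‖v‖ ≤ 21 * k := by nlinarith
    calc ‖holeCentre k j + ((ρ - 1 : ℝ) : ℂ) * v + (μ : ℂ) * v * Complex.I‖
        ≤ ‖holeCentre k j‖ + ‖((ρ - 1 : ℝ) : ℂ) * v‖ + ‖(μ : ℂ) * v * Complex.I‖ := norm_add₃_le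
      _ ≤ 4 * k + (ρ - 1) * (21 * k) + ρ * (178 / 100) := by
          gcongr
          rw [norm_mul, Complex.norm_real, Real.norm_eq_abs, abs_of_pos (by linarith)]; gcongr
      _ ≤ 40 * ((k : ℝ) + 1) / 2 := by nlinarith

/-- **A tube point stays away from the other holes, off their far branch cuts**: for `l ≠ j` and
`z = (1 - ρ) z₀ + ρ c_j + i μ v_j` with `0 < ρ ≤ 11/10`, `|μ| |v_j| ≤ 1.78 ρ`: `|z - c_l| ≥ 27/20` and
`Im((z - c_l) \overline{(z₀ - c_l)}) ≠ 0`. [folklore] -/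
theorem tubePoint_otherHole {k : ℕ} {j l : Fin k} (hjl : j ≠ l) {v v' : ℂ}
    (hv : v = holeCentre k j - Complex.mk 0 (-(20 * (k : ℝ))))
    (hv' : v' = holeCentre k l - Complex.mk 0 (-(20 * (k : ℝ))))
    {ρ μ : ℝ} (hρ0 : 0 < ρ) (hρ1 : ρ ≤ 11 / 10) (hμ : |μ| * ‖v‖ ≤ ρ * (178 / 100)) (z : ℂ)
    (hz : z = ((1 - ρ : ℝ) : ℂ) * Complex.mk 0 (-(20 * (k : ℝ))) + (ρ : ℂ) * (Complex.mk 0 (-(20 * (k : ℝ))) + v) +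
      (μ : ℂ) * v * Complex.I) :
    27 / 20 ≤ ‖z - holeCentre k l‖ ∧ ((z - holeCentre k l) * conj (Complex.mk 0 (-(20 * (k : ℝ))) - holeCentre k l)).im ≠ 0 := by
  obtain ⟨-, -, hk, -, -, h20, h416, hv0, hVpos⟩ := holeDir_props j hv
  obtain ⟨-, -, -, -, -, h20', h416', hv0', hVpos'⟩ := holeDir_props l hv'
  obtain ⟨-, -, hQ, hP0, hPle⟩ := holePair_props hjl hv hv'
  generalize hP : (v * conj v').re = P at hQ hP0 hPle
  generalize hQ' : (v * conj v').im = Q at hQ hP0 hPle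
  have hX : v * conj v' = Complex.mk P Q := Complex.ext hP hQ'
  -- `z - c_l = ρ v + i μ v - v'`
  have hzl : z - holeCentre k l = (ρ : ℂ) * v + (μ : ℂ) * v * Complex.I - v' := by
    rw [hz, hv']; push_cast; ring
  have hvv : v * conj v = ((‖v‖ ^ 2 : ℝ) : ℂ) := by rw [Complex.mul_conj, Complex.normSq_eq_norm_sq]
  have hvv' : v' * conj v' = ((‖v'‖ ^ 2 : ℝ) : ℂ) := by rw [Complex.mul_conj, Complex.normSq_eq_norm_sq]
  -- `|v| ≤ 20.4 k ≤ 80 k / 3.92`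
  have hv392 : 392 / 100 * ‖v‖ ≤ 80 * k := by nlinarith
  have hv204' : ‖v'‖ ≤ 204 / 10 * k := by nlinarith
  constructor
  · -- distance: `|(z - c_l) \bar v| ≥ |Im| = |μ |v|² + Q| ≥ |Q| - 1.96 |v|`
    have e1 : (z - holeCentre k l) * conj v =
        (ρ : ℂ) * ((‖v‖ ^ 2 : ℝ) : ℂ) + (μ : ℂ) * ((‖v‖ ^ 2 : ℝ) : ℂ) * Complex.I - conj (Complex.mk P Q) := by
      rw [hzl, ← hX, map_mul, Complex.conj_conj]
      linear_combination ((ρ : ℂ) + (μ : ℂ) * Complex.I) * hvv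
    have him1 : ((z - holeCentre k l) * conj v).im = μ * ‖v‖ ^ 2 + Q := by
      rw [e1]
      simp only [Complex.sub_im, Complex.add_im, Complex.mul_im, Complex.mul_re, Complex.ofReal_re,
        Complex.ofReal_im, Complex.I_re, Complex.I_im, Complex.conj_im]
      ring
    have hbound : |Q| - |μ| * ‖v‖ ^ 2 ≤ ‖z - holeCentre k l‖ * ‖v‖ := by
      have h2 : |((z - holeCentre k l) * conj v).im| ≤ ‖(z - holeCentre k l) * conj v‖ := Complex.abs_im_le_norm _
      rw [norm_mul, Complex.norm_conj, him1] at h2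
      have h3 := abs_add_le (μ * ‖v‖ ^ 2 + Q) (-(μ * ‖v‖ ^ 2))
      rw [show μ * ‖v‖ ^ 2 + Q + -(μ * ‖v‖ ^ 2) = Q by ring, abs_neg, abs_mul,
        abs_of_nonneg (by positivity : (0 : ℝ) ≤ ‖v‖ ^ 2)] at h3
      linarith
    have h2 : |μ| * ‖v‖ ^ 2 ≤ 196 / 100 * ‖v‖ := by nlinarith [abs_nonneg μ]
    nlinarith [norm_nonneg (z - holeCentre k l)]
  · -- the imaginary part of `(z - c_l) \overline{(z₀ - c_l)} = -(z - c_l) \bar v'` is `-(ρ Q + μ P)`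
    have e0 : Complex.mk 0 (-(20 * (k : ℝ))) - holeCentre k l = -v' := by rw [hv']; ring
    have e2 : (z - holeCentre k l) * conj v' =
        (ρ : ℂ) * Complex.mk P Q + (μ : ℂ) * Complex.mk P Q * Complex.I - ((‖v'‖ ^ 2 : ℝ) : ℂ) := by
      rw [hzl, ← hX, ← hvv']; ring
    have him2 : ((z - holeCentre k l) * conj v').im = ρ * Q + μ * P := by
      rw [e2]
      simp only [Complex.sub_im, Complex.add_im, Complex.mul_im, Complex.mul_re, Complex.ofReal_re,
        Complex.ofReal_im, Complex.I_re, Complex.I_im]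
      ring
    rw [e0, map_neg, mul_neg, Complex.neg_im, neg_ne_zero, him2]
    -- `|ρ Q| ≥ 80 k ρ > 1.78 ρ · 20.4 k ≥ |μ P|`
    have hμP : |μ * P| ≤ ρ * (178 / 100) * ‖v'‖ := by
      rw [abs_mul, abs_of_pos hP0]
      calc |μ| * P ≤ |μ| * (‖v‖ * ‖v'‖) := by gcongr
        _ = |μ| * ‖v‖ * ‖v'‖ := by ring
        _ ≤ ρ * (178 / 100) * ‖v'‖ := by gcongr
    intro h0
    have hρQ : ρ * (80 * k) ≤ |ρ * Q| := by rw [abs_mul, abs_of_pos hρ0]; gcongr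
    rw [show ρ * Q = -(μ * P) by linarith, abs_neg] at hρQ
    nlinarith

/-- **Points of distinct tubes have distinct `z`**: if `ρ v_j (1 + i m/|v_j|) = ρ' v_l (1 + i m'/|v_l|)` with
`ρ, ρ' > 0`, `|m|, |m'| ≤ 1.78`, then `j = l` — the windows `c_j + i m v_j/|v_j|` are seen from `z₀` in disjoint
cones. [folklore] -/
theorem tubePoints_ne {k : ℕ} {j l : Fin k} (hjl : j ≠ l) {v v' : ℂ}
    (hv : v = holeCentre k j - Complex.mk 0 (-(20 * (k : ℝ))))
    (hv' : v' = holeCentre k l - Complex.mk 0 (-(20 * (k : ℝ))))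
    {ρ ρ' m m' : ℝ} (hρ : 0 < ρ) (hρ' : 0 < ρ') (hm : |m| ≤ 178 / 100) (hm' : |m'| ≤ 178 / 100) :
    (ρ : ℂ) * v * (1 + ((m / ‖v‖ : ℝ) : ℂ) * Complex.I) ≠ (ρ' : ℂ) * v' * (1 + ((m' / ‖v'‖ : ℝ) : ℂ) * Complex.I) := by
  obtain ⟨-, -, hk, -, -, h20, h416, hv0, hVpos⟩ := holeDir_props j hv
  obtain ⟨-, -, -, -, -, h20', h416', hv0', hVpos'⟩ := holeDir_props l hv'
  obtain ⟨-, -, hQ, hP0, hPle⟩ := holePair_props hjl hv hv'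
  generalize hP : (v * conj v').re = P at hQ hP0 hPle
  generalize hQ' : (v * conj v').im = Q at hQ hP0 hPle
  have hX : v * conj v' = Complex.mk P Q := Complex.ext hP hQ'
  intro h
  -- multiply by the conjugate of the right-hand side: the product is real
  set a : ℝ := m / ‖v‖ with ha
  set a' : ℝ := m' / ‖v'‖ with ha'
  have hreal : ((ρ : ℂ) * v * (1 + (a : ℂ) * Complex.I) * conj ((ρ' : ℂ) * v' * (1 + (a' : ℂ) * Complex.I))).im = 0 := by
    rw [h, Complex.mul_conj, Complex.ofReal_im]
  have hexp : (ρ : ℂ) * v * (1 + (a : ℂ) * Complex.I) * conj ((ρ' : ℂ) * v' * (1 + (a' : ℂ) * Complex.I)) =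
      ((ρ * ρ' : ℝ) : ℂ) * (Complex.mk P Q * Complex.mk (1 + a * a') (a - a')) := by
    rw [← hX]
    have hc : conj ((ρ' : ℂ) * v' * (1 + (a' : ℂ) * Complex.I)) = (ρ' : ℂ) * conj v' * (1 - (a' : ℂ) * Complex.I) := by
      simp only [map_mul, map_add, map_one, Complex.conj_ofReal, Complex.conj_I]; ring
    rw [hc]
    have hmk : Complex.mk (1 + a * a') (a - a') = (1 + (a : ℂ) * Complex.I) * (1 - (a' : ℂ) * Complex.I) := by
      apply Complex.ext
      · simp
      · simp; ring
    rw [hmk]; push_cast; ring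
  rw [hexp, Complex.im_ofReal_mul] at hreal
  have hprod : (Complex.mk P Q * Complex.mk (1 + a * a') (a - a')).im = 0 := by
    rcases mul_eq_zero.1 hreal with h0 | h0
    · exact absurd h0 (mul_pos hρ hρ').ne'
    · exact h0
  have hrel : P * (a - a') + Q * (1 + a * a') = 0 := by simpa [Complex.mul_im] using hprod
  -- bounds: `P |a| ≤ 1.78 |v'|`, `P |a'| ≤ 1.78 |v|`, `|a a'| ≤ (1.78/20)²`
  have haV : |a| * ‖v‖ = |m| := by rw [ha, abs_div, abs_of_pos hVpos]; field_simp
  have haV' : |a'| * ‖v'‖ = |m'| := by rw [ha', abs_div, abs_of_pos hVpos']; field_simp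
  have h1 : P * |a| ≤ 178 / 100 * ‖v'‖ := by
    calc P * |a| ≤ ‖v‖ * ‖v'‖ * |a| := by gcongr
      _ = |a| * ‖v‖ * ‖v'‖ := by ring
      _ = |m| * ‖v'‖ := by rw [haV]
      _ ≤ 178 / 100 * ‖v'‖ := by gcongr
  have h2 : P * |a'| ≤ 178 / 100 * ‖v‖ := by
    calc P * |a'| ≤ ‖v‖ * ‖v'‖ * |a'| := by gcongr
      _ = |a'| * ‖v'‖ * ‖v‖ := by ring
      _ = |m'| * ‖v‖ := by rw [haV']
      _ ≤ 178 / 100 * ‖v‖ := by gcongr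
  have ha1 : |a| ≤ 178 / 100 / 20 := by
    rw [le_div_iff₀ (by norm_num : (0 : ℝ) < 20)]
    calc |a| * 20 ≤ |a| * ‖v‖ := by gcongr
      _ = |m| := haV
      _ ≤ 178 / 100 := hm
  have ha2 : |a'| ≤ 178 / 100 / 20 := by
    rw [le_div_iff₀ (by norm_num : (0 : ℝ) < 20)]
    calc |a'| * 20 ≤ |a'| * ‖v'‖ := by gcongr
      _ = |m'| := haV'
      _ ≤ 178 / 100 := hm'
  have haa : |a * a'| ≤ (178 / 100 / 20) ^ 2 := by rw [abs_mul, pow_two]; exact mul_le_mul ha1 ha2 (abs_nonneg _) (by norm_num)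
  -- `|Q| (1 - |aa'|) ≤ P (|a| + |a'|) ≤ 1.78 (|v| + |v'|) ≤ 1.78 · 40.8 k < 0.992 · 80 k ≤ 0.992 |Q|`
  have hv204 : ‖v‖ ≤ 204 / 10 * k := by nlinarith
  have hv204' : ‖v'‖ ≤ 204 / 10 * k := by nlinarith
  have key : |Q| * (1 - (178 / 100 / 20) ^ 2) ≤ 178 / 100 * (‖v‖ + ‖v'‖) := by
    have e : Q * (1 + a * a') = -(P * (a - a')) := by linarith
    have h3 : |Q| * (1 - (178 / 100 / 20) ^ 2) ≤ |Q * (1 + a * a')| := by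
      rw [abs_mul]
      apply mul_le_mul_of_nonneg_left _ (abs_nonneg Q)
      have := neg_abs_le (a * a')
      rw [abs_of_pos (by nlinarith)]; linarith
    have h4 : |Q * (1 + a * a')| ≤ P * |a| + P * |a'| := by
      rw [e, abs_neg, abs_mul, abs_of_pos hP0, ← mul_add]
      exact mul_le_mul_of_nonneg_left (abs_sub _ _) hP0.le
    linarith
  nlinarith

/-! ## Membership in the model handlebody -/

/-- **A point near the holes' row but away from the holes lies in `D_k ∩ {G_k < 1}`**: if `|z| ≤ R/2`
(`R = 40(k+1)`), every hole is at distance `≥ 27/20` and `|w|² ≤ 1/20` then `(z, w) ∈ D_k` with `G_k < 1`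
(zone estimates `MMSW.potential_lt_of_annulus`, `MMSW.potential_lt_of_forall_le_dist`). [folklore] -/
theorem mem_modelHandlebody_of_far (k : ℕ) {z w : ℂ} (hz : ‖z‖ ≤ 40 * ((k : ℝ) + 1) / 2)
    (hfar : ∀ j : Fin k, 27 / 20 ≤ ‖z - holeCentre k j‖) (hw : ‖w‖ ^ 2 ≤ 1 / 20) :
    ofZW z w ∈ modelHandlebody k ∧ levelFun k (ofZW z w) < 1 := by
  have hpot : Complex.normSq z / (40 * ((k : ℝ) + 1)) ^ 2 +
      ∑ j : Fin k, (Complex.normSq (z - holeCentre k j))⁻¹ < 19 / 20 := by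
    by_cases h8 : 40 * ((k : ℝ) + 1) / 8 ≤ ‖z‖
    · exact potential_lt_of_annulus z h8 hz
    · exact potential_lt_of_forall_le_dist z (le_of_not_ge h8) hfar
  have hG : levelFun k (ofZW z w) < 1 := by
    have h := levelFun_sub_normSq_w (r := k) (ofZW z w)
    rw [zC_ofZW] at h
    have hw' : (ofZW z w 2) ^ 2 + (ofZW z w 3) ^ 2 = ‖w‖ ^ 2 := by
      rw [← Complex.normSq_eq_norm_sq, Complex.normSq_apply]; simp [sq]
    linarith
  refine ⟨⟨fun j => ?_, hG.le⟩, hG⟩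
  rw [holeTerm_eq_normSq, zC_ofZW, Complex.normSq_eq_norm_sq]
  nlinarith [hfar j]

/-- **The base ball**: `B̄((z₀, 0), 1/5) ⊆ D_k` for `z₀ = -20k i` (`ModelHandles.closedBall_subset_modelHandlebody`).
[folklore] -/
theorem baseBall_subset (k : ℕ) :
    closedBall (ofZW (Complex.mk 0 (-(20 * (k : ℝ)))) 0) (1 / 5) ⊆ modelHandlebody k := by
  intro x hx
  refine (closedBall_subset_modelHandlebody k _ ?_ (fun j => ?_) x hx).1
  · rw [(norm_centre_holeCentre k).1]; linarith
  · obtain ⟨-, -, -, -, -, h20, -⟩ := holeDir_props j (v := holeCentre k j - Complex.mk 0 (-(20 * (k : ℝ)))) rfl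
    rw [norm_sub_rev]; linarith

/-! ## The end values of the lift about the tube's own hole -/

/-- **End values**: for `Im v > 0` and `Im w ≠ 0`,
`arg w + arg v = arg(-w) + arg(-v) + (2π if Im w > 0, else 0)`. [folklore] -/
theorem arg_end_value {w v : ℂ} (hv : 0 < v.im) (hw : w.im ≠ 0) :
    Complex.arg w + Complex.arg v =
      Complex.arg (-w) + Complex.arg (-v) + (if 0 < w.im then 2 * Real.pi else 0) := by
  rw [Complex.arg_neg_eq_arg_sub_pi_of_im_pos hv]
  rcases lt_or_gt_of_ne hw with h | h
  · rw [Complex.arg_neg_eq_arg_add_pi_of_im_neg h, if_neg (not_lt.2 h.le)]; ring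
  · rw [Complex.arg_neg_eq_arg_sub_pi_of_im_pos h, if_pos h]; ring

/-- **The lift about a hole is smooth where its product with the reference direction is off the cut**, and
exponentiates to the unit vector of `z - e`. [folklore] -/
theorem lift_props {Z : EuclideanSpace ℝ (Fin 4) → ℂ} {W : Set (EuclideanSpace ℝ (Fin 4))} {e D : ℂ}
    (hZ : ContDiffOn ℝ ∞ Z W) (hD : D ≠ 0) (hslit : ∀ p ∈ W, (Z p - e) * conj D ∈ Complex.slitPlane) :
    ContDiffOn ℝ ∞ (fun p => Complex.arg ((Z p - e) * conj D) + Complex.arg D) W ∧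
    ∀ p ∈ W, Complex.exp (((Complex.arg ((Z p - e) * conj D) + Complex.arg D : ℝ) : ℂ) * Complex.I) =
      (Z p - e) / (((‖Z p - e‖ : ℝ)) : ℂ) := by
  constructor
  · intro p hp
    refine ContDiffWithinAt.add ?_ contDiffWithinAt_const
    have h1 : ContDiffWithinAt ℝ ∞ (fun p => (Z p - e) * conj D) W p :=
      ((hZ p hp).sub contDiffWithinAt_const).mul contDiffWithinAt_const
    exact (contDiffAt_arg (hslit p hp)).comp_contDiffWithinAt p h1
  · intro p hp
    have hne : Z p - e ≠ 0 := by
      intro h0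
      have := hslit p hp
      rw [h0, zero_mul] at this
      exact Complex.slitPlane_ne_zero this rfl
    exact (unit_eq_exp_ballBranch hne hD).symm

end ModelHandles

/-- **Registered piece `helper_handlebodyChart_modelHandles_holesFromCentre` of the data stub, part 1 (the holes seen
from the base centre `z₀ = -20k i`)**: the base ball `B̄((z₀, 0), 1/5)` lies in `D_k`
(`ModelHandles.baseBall_subset`); a point `(z, w)` with `|z| ≤ 20(k+1)`, all holes at distance `≥ 27/20` and
`|w|² ≤ 1/20` lies in `D_k` (`ModelHandles.mem_modelHandlebody_of_far`); and the end-value identity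
`arg w + arg v = arg(-w) + arg(-v) + 2π[Im w > 0]` (`ModelHandles.arg_end_value`). [folklore] -/
theorem helper_handlebodyChart_modelHandles_holesFromCentre : (∀ k : ℕ, Metric.closedBall (Literature.AlgebraicTopology.Homotopy.HopfFibration.ofZW (Complex.mk 0 (-(20 * (k : ℝ)))) 0) (1 / 5) ⊆ Literature.Topology.FourManifolds.MMSW.modelHandlebody k) ∧ (∀ (k : ℕ) (z w : ℂ), ‖z‖ ≤ 40 * ((k : ℝ) + 1) / 2 → (∀ j : Fin k, 27 / 20 ≤ ‖z - Literature.Topology.FourManifolds.MMSW.holeCentre k j‖) → ‖w‖ ^ 2 ≤ 1 / 20 → Literature.AlgebraicTopology.Homotopy.HopfFibration.ofZW z w ∈ Literature.Topology.FourManifolds.MMSW.modelHandlebody k ∧ Literature.Topology.FourManifolds.MMSW.levelFun k (Literature.AlgebraicTopology.Homotopy.HopfFibration.ofZW z w) < 1) ∧ (∀ (w v : ℂ), 0 < v.im → w.im ≠ 0 → Complex.arg w + Complex.arg v = Complex.arg (-w) + Complex.arg (-v) + (if 0 < w.im then 2 * Real.pi else 0)) :=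
  ⟨ModelHandles.baseBall_subset, fun k _ _ hz hfar hw => ModelHandles.mem_modelHandlebody_of_far k hz hfar hw,
   fun _ _ hv hw => ModelHandles.arg_end_value hv hw⟩

end Summit.SmoothPoincare4.SmoothPoincare4.Theorems.DcrGap.MkFriends

end
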